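import Summits.BirchSwinnertonDyer.BirchSwinnertonDyer.Theorems.GenusKolyvaginAtTwoGenusPrimitiveSupplyAtTwoTwistSelmerTransferUpRat
import Summits.BirchSwinnertonDyer.BirchSwinnertonDyer.Theorems.GenusKolyvaginAtTwoGenusPrimitiveSupplyAtTwoSupplyDEF1OfDuality
import HarnessLib

/-!
# Route `GenusKolyvaginAtTwo`, crux #2 `GenusPrimitiveSupplyAtTwo` (stmt-BirchSwinnertonDyer-22136):
# SUPPLY″ (the DEF = 1 Sel₂-minimal twin beyond every bound) with `prop33_rat` AND `cor34i_singleton_rat` REPLACED by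
# Poitou–Tate duality, Tate's local Euler characteristic and Kramer's congruence

Width seat `bsd-line-gk2-p5` g9 (cell `bsd-f1-sign2`, SUPPLY lineage), file 16 of the series (crux workfile
`Lines/genus-supply-mr-instantiation.md`). THEOREMS ONLY (no definition, no named fact introduced here, no `sorry`); helper
`--supports stmt-BirchSwinnertonDyer-22136`; no item is closed; BSD is not proved by any of this.

WHAT. g8's `…SupplyDEF1OfDuality.lean` (p626232) removed `cor34i_singleton_rat` from the cell's SUPPLY″ (the `#Sel₂ = 4` rows use only
the DOWN half of Cor. 3.4 (i)); the `#Sel₂ = 1` rows on `Δ < 0` still rested on `MazurRubin2010.prop33_rat` through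
`GenusKolyTwin.exists_prime_heegnerField_minimalTwin_of_prop33` — there the trivial Selmer group is strict at the twisting prime and
the rank goes UP, which needs the parity input. With the UP half now a kernel theorem modulo {PT, Tate χ, Kramer parity}
(`GenusKolyTwin.natCard_selmerGroup_twin_eq_two_of_parity`, file `…TwistSelmerTransferUpRat.lean`), the three statements are re-derived
— statements and proofs VERBATIM — with `h33` replaced by `hKP : MazurRubin2010.kramerParity ℚ` (the habitat's `ρ̄_{W,2}` onto is
already a binder):

* §38 `exists_prime_heegnerField_minimalTwin_of_parity` — `Δ_W < 0`, `#Sel₂(W) = 1`: beyond every bound a PRIME Heegner field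
  `ℚ(√−ℓ)` with all K-clauses of the crux, `2` split, DEF = 1, and a globally minimal twin with `#Sel₂ = 2`.
* §39 `supply_DEF1_minimalTwin_of_parity`, `supply_DEF1_minimalTwin_habitat_of_parity` — SUPPLY″ on the habitat cut out by
  `#Sel₂(E) ∈ {1, 4}` (and `ε(E) = +1` on `Δ > 0` row 1) modulo {PT, Tate χ, Kramer parity} on `Δ < 0` and {T-A, T-V} on `Δ > 0`
  — NO Mazur–Rubin 2010 named fact remains.

References: [MazurRubin2010] Thm. 2.7, Prop. 3.3, Cor. 3.4 (i), Prop. 5.3; [Kramer1981] Thms 1–2, Props 6–7; [MilneADT2006]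
I Thm. 2.8, I Thm. 4.10; [GrossLMS1991] §1.
-/

set_option linter.dupNamespace false -- tree convention: `Summit.BirchSwinnertonDyer.BirchSwinnertonDyer.Theorems` (summit = sub-problem)
set_option autoImplicit false

noncomputable section

open scoped Classical Pointwise

open NumberField WeierstrassCurve IsDedekindDomain
open Literature.NumberTheory.EllipticCurves Literature.NumberTheory.QuadraticFields
open Literature.NumberTheory.GaloisRepresentations Literature.NumberTheory.GaloisCohomology Literature.NumberTheory
open Summit.BirchSwinnertonDyer.Rank1Residual.F1Sign2

namespace Summit.BirchSwinnertonDyer.BirchSwinnertonDyer.Theorems.GenusKolyTwin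

open Summit.BirchSwinnertonDyer.BirchSwinnertonDyer.Theorems.GenusKolyTwistingPrime (supply_DEF1_minimalTwin_rowOne_of_duality)

variable (W : WeierstrassCurve ℚ) [W.IsElliptic] [W.IsGloballyMinimal]

/-! ## §38 The `#Sel₂(E) = 1` rows on `Δ < 0`: every prime Heegner field beyond any bound carries a Sel₂-minimal twin -/

/-- **SUPPLY″-Selmer on the cell {Δ < 0, #Sel₂(E) = 1}, modulo Poitou–Tate duality, Tate's local Euler characteristic and Kramer's
congruence (PRINT, statement-level) — `exists_prime_heegnerField_minimalTwin_of_prop33` with `prop33_rat` REPLACED.** For `W/ℚ`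
globally minimal elliptic with `ρ̄_{W,2}` onto, `Δ_W < 0` and `#Sel₂(W) = 1` (`Ш(E)[2] = 0`, `E(ℚ)[2] = 0`), beyond every bound `n`
there is a PRIME Heegner field `K = ℚ(√−ℓ)` (`ℓ > n`) carrying ALL the K-clauses of crux 22136 (imaginary quadratic, `d_K` odd,
`d_K ≠ −3`, Heegner for `N_W`, `d_K·(−|Δ|)`, `d_K·(−2|Δ|)` non-squares), `2` split, DEF(W,K) = 1 (its one prime is a transposition
prime), together with a GLOBALLY MINIMAL model `Wd` of `W^{(d_K)}` with `#Sel₂(Wd) = 2` (the trivial Selmer group is strict at `ℓ`, so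
the rank goes UP by one: `GenusKolyTwin.natCard_selmerGroup_twin_eq_two_of_parity`). The twin's analytic rank one is not asserted.
[cite: MazurRubin2010, Thm. 2.7, Prop. 3.3 and Cor. 3.4 (i)] [cite: GrossLMS1991, §1 (p. 235)] -/
theorem exists_prime_heegnerField_minimalTwin_of_parity (hPT : poitouTate_selmerStructure_duality_real ℚ)
    (hEP : ∀ v : IsDedekindDomain.HeightOneSpectrum (𝓞 ℚ), localEulerPoincareCharacteristic (v.adicCompletion ℚ))
    (hKP : MazurRubin2010.kramerParity ℚ) (hsurj : W.HasSurjectiveModNGaloisRep 2) (hΔ : W.Δ < 0)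
    (h1 : Nat.card (W.selmerGroup 2) = 1) (n : ℕ) :
    ∃ (K : Type) (_ : Field K) (_ : NumberField K) (ℓ : ℕ), ℓ.Prime ∧ n < ℓ ∧
      IsImaginaryQuadratic K ∧ discr K = -(ℓ : ℤ) ∧ Odd (discr K) ∧ discr K ≠ -3 ∧
      SatisfiesHeegnerHypothesis (W.conductorNorm ℤ) K ∧
      ¬ IsSquare ((discr K : ℚ) * -|W.Δ|) ∧ ¬ IsSquare ((discr K : ℚ) * (-(2 * |W.Δ|))) ∧
      ((Ideal.span {(2 : ℤ)}).primesOver (𝓞 K)).ncard = 2 ∧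
      (∃! x : ZMod ℓ, 4 * x ^ 3 + ((integralModelInt W).b₂ : ZMod ℓ) * x ^ 2 +
        2 * ((integralModelInt W).b₄ : ZMod ℓ) * x + ((integralModelInt W).b₆ : ZMod ℓ) = 0) ∧
      ∃ (Wd : WeierstrassCurve ℚ) (_ : Wd.IsElliptic) (_ : Wd.IsGloballyMinimal),
        (∃ C : VariableChange ℚ, C • W.quadraticTwist (discr K : ℚ) = Wd) ∧ Nat.card (Wd.selmerGroup 2) = 2 := by
  obtain ⟨K, _, _, ℓ, hℓ, hℓn, -, -, hK, hd, hodd, hd3, hH, h2K, hsq1, hsq2⟩ := exists_prime_heegnerField W n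
  haveI := Fact.mk hℓ
  -- a globally minimal model of the twist
  have hd0 : ((discr K : ℤ) : ℚ) ≠ 0 := by exact_mod_cast NumberField.discr_ne_zero K
  haveI := W.isElliptic_quadraticTwist hd0
  obtain ⟨C, hC⟩ := hasGlobalMinimalModel_rat_holds (W.quadraticTwist ((discr K : ℤ) : ℚ))
  haveI := hC
  refine ⟨K, inferInstance, inferInstance, ℓ, hℓ, hℓn, hK, hd, hodd, hd3, hH, hsq1, hsq2, h2K,
    existsUnique_zmod_root_of_discr_eq_neg_prime_of_Δ_neg W hK hodd hH hd hΔ,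
    C • W.quadraticTwist ((discr K : ℤ) : ℚ), inferInstance, hC, ⟨C, rfl⟩, ?_⟩
  exact natCard_selmerGroup_twin_eq_two_of_parity W hPT hEP hKP hsurj hΔ hK hodd hH h2K hd _ ⟨C, rfl⟩ h1

/-! ## §39 SUPPLY″ on the habitat, modulo {PT, Tate χ, Kramer parity, T-A, T-V} — no Mazur–Rubin 2010 named fact -/

/-- **SUPPLY″ («MinimalTwinSupplyDEF1») on the habitat cut out by `#Sel₂(E) ∈ {1, 4}` and `ε(E) = +1 on Δ > 0 row 1`, modulo
print/typed facts BY NAME — as g8's `supply_DEF1_minimalTwin_of_duality` but with `MazurRubin2010.prop33_rat` ALSO replaced, by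
{PT, Tate χ, Kramer parity}** — Poitou–Tate duality + Tate's local Euler characteristic `hPT`, `hEP` and Kramer's congruence `hKP`
(Δ<0: `#Sel₂ = 1` via §38 UP, `#Sel₂ = 4` via gk2-p4 g7 twisting primes ∘ g8 DOWN), T-A `F1Sign2.AdmissibleTwistSelmerShiftAtTwo`
(Δ>0, `#Sel₂ = 1`) and T-V `F1Sign2.StrictShaPropagationAtTwo` (Δ>0, `#Sel₂ = 4`, `¬ DescentSignNeg`); every Čebotarev / Dirichlet
input is PROVED. Statement VERBATIM as `supply_DEF1_minimalTwin_of_duality`: for `W/ℚ` globally minimal elliptic with `ρ̄_{W,2}` onto,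
rank `0`, `#Sel₂(W) ∈ {1, 4}`, and `¬ F1Sign2.DescentSignNeg W` whenever `Δ_W > 0` and `#Sel₂(W) = 4`: beyond every bound `b` there is
a prime `ℓ ≡ 7 (mod 8)`, `ℓ ∤ N_W`, such that `K = ℚ(√−ℓ)` carries EVERY K-clause of crux 22136 with `2` split, DEF(W,K) = 1 in
root-count currency, and the twist has a GLOBALLY MINIMAL model `Wd ≅ W^{(−ℓ)}` with `#Sel₂(Wd) = 2`. The twin's analytic rank one
is NOT asserted. BSD is not proved by any of this.
[cite: MazurRubin2010, Thm. 2.7, Prop. 3.3, Cor. 3.4 (i), Prop. 5.3] [cite: Kramer1981, Prop. 6] [cite: GrossLMS1991, §1 (p. 235)] -/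
theorem supply_DEF1_minimalTwin_of_parity (hKP : MazurRubin2010.kramerParity ℚ)
    (hPT : poitouTate_selmerStructure_duality_real ℚ)
    (hEP : ∀ v : IsDedekindDomain.HeightOneSpectrum (𝓞 ℚ), localEulerPoincareCharacteristic (v.adicCompletion ℚ))
    (hA : AdmissibleTwistSelmerShiftAtTwo) (hV : StrictShaPropagationAtTwo)
    (hsurj : W.HasSurjectiveModNGaloisRep 2) (hr : W.mordellWeilRank = 0)
    (h14 : Nat.card (W.selmerGroup 2) = 1 ∨ Nat.card (W.selmerGroup 2) = 4)
    (hε : 0 < W.Δ → Nat.card (W.selmerGroup 2) = 4 → ¬ DescentSignNeg W) (b : ℕ) :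
    ∃ ℓ : ℕ, b < ℓ ∧ ℓ.Prime ∧ ℓ % 8 = 7 ∧ ¬ ℓ ∣ W.conductorNorm ℤ ∧
      ((W.Δ < 0 ∧ ∃! x : ZMod ℓ, 4 * x ^ 3 + ((integralModelInt W).b₂ : ZMod ℓ) * x ^ 2 +
          2 * ((integralModelInt W).b₄ : ZMod ℓ) * x + ((integralModelInt W).b₆ : ZMod ℓ) = 0) ∨
        (0 < W.Δ ∧ ∀ x : ZMod ℓ, 4 * x ^ 3 + ((integralModelInt W).b₂ : ZMod ℓ) * x ^ 2 +
          2 * ((integralModelInt W).b₄ : ZMod ℓ) * x + ((integralModelInt W).b₆ : ZMod ℓ) ≠ 0)) ∧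
      ∃ (K : Type) (_ : Field K) (_ : NumberField K), IsImaginaryQuadratic K ∧ discr K = -(ℓ : ℤ) ∧ Odd (discr K) ∧
        discr K ≠ -3 ∧ SatisfiesHeegnerHypothesis (W.conductorNorm ℤ) K ∧
        ¬ IsSquare ((discr K : ℚ) * -|W.Δ|) ∧ ¬ IsSquare ((discr K : ℚ) * (-(2 * |W.Δ|))) ∧
        ((Ideal.span {(2 : ℤ)}).primesOver (𝓞 K)).ncard = 2 ∧
        ∃ (Wd : WeierstrassCurve ℚ) (_ : Wd.IsElliptic) (_ : Wd.IsGloballyMinimal),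
          (∃ C : VariableChange ℚ, C • W.quadraticTwist (discr K : ℚ) = Wd) ∧ Nat.card (Wd.selmerGroup 2) = 2 := by
  rcases lt_or_gt_of_ne W.isUnit_Δ.ne_zero with hΔ | hΔ
  · -- `Δ < 0`: prime Heegner fields are transposition fields (DEF = 1 for free)
    rcases h14 with h1 | h4
    · obtain ⟨K, _, _, ℓ, hℓ, hb, hK, hd, hodd, hd3, hH, hsq1, hsq2, h2K, huniq, Wd, _, _, hWd, hSel⟩ :=
        exists_prime_heegnerField_minimalTwin_of_parity W hPT hEP hKP hsurj hΔ h1 b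
      obtain ⟨-, hℓN, -⟩ := prime_discr_facts W hK hodd hH hℓ hd
      have hℓ8 : ℓ % 8 = 7 := by
        have h8 := (Quadratic.ncard_primesOver_two_eq_two_iff hK.1).mp h2K
        rw [hd] at h8
        omega
      exact ⟨ℓ, hb, hℓ, hℓ8, hℓN, Or.inl ⟨hΔ, huniq⟩, K, inferInstance, inferInstance, hK, hd, hodd, hd3, hH, hsq1, hsq2,
        h2K, Wd, inferInstance, inferInstance, hWd, hSel⟩
    · obtain ⟨ℓ, hℓ, hb, hℓ8, hℓ2N, K, _, _, hK, hd, hodd, hd3, hH, hsq1, hsq2, h2K, huniq, Wd, _, _, hWd, hSel⟩ :=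
        supply_DEF1_minimalTwin_rowOne_of_duality W hPT hEP hΔ hsurj h4 b
      have hℓN : ¬ ℓ ∣ W.conductorNorm ℤ := fun h => hℓ2N (Dvd.dvd.mul_left h 2)
      exact ⟨ℓ, hb, hℓ, hℓ8, hℓN, Or.inl ⟨hΔ, huniq⟩, K, inferInstance, inferInstance, hK, hd, hodd, hd3, hH, hsq1, hsq2,
        h2K, Wd, inferInstance, inferInstance, hWd, hSel⟩
  · -- `Δ > 0`: silent prime Heegner fields (DEF = 1), the sign `ε(W)` on row 1
    rcases h14 with h1 | h4
    · obtain ⟨ℓ, hb, hℓ, hsil, K, _, _, hK, hd, hodd, hd3, hH, hsq1, hsq2, h2K, -, Wd, _, _, hWd, hSel⟩ :=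
        supply_DEF1_posDisc W hA hΔ hsurj h1 b
      obtain ⟨-, hℓN, -⟩ := prime_discr_facts W hK hodd hH hℓ hd
      have hℓ8 : ℓ % 8 = 7 := by
        have h8 := (Quadratic.ncard_primesOver_two_eq_two_iff hK.1).mp h2K
        rw [hd] at h8
        omega
      exact ⟨ℓ, hb, hℓ, hℓ8, hℓN, Or.inr ⟨hΔ, hsil⟩, K, inferInstance, inferInstance, hK, hd, hodd, hd3, hH, hsq1, hsq2,
        h2K, Wd, inferInstance, inferInstance, hWd, hSel⟩
    · obtain ⟨ℓ, hb, hℓ, hsil, K, _, _, hK, hd, hodd, hd3, hH, hsq1, hsq2, h2K, -, Wd, _, _, hWd, hSel⟩ :=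
        supply_DEF1_posDisc_rowOne_of_not_descentSignNeg W hV hΔ hsurj hr h4 (hε hΔ h4) b
      obtain ⟨-, hℓN, -⟩ := prime_discr_facts W hK hodd hH hℓ hd
      have hℓ8 : ℓ % 8 = 7 := by
        have h8 := (Quadratic.ncard_primesOver_two_eq_two_iff hK.1).mp h2K
        rw [hd] at h8
        omega
      exact ⟨ℓ, hb, hℓ, hℓ8, hℓN, Or.inr ⟨hΔ, hsil⟩, K, inferInstance, inferInstance, hK, hd, hodd, hd3, hH, hsq1, hsq2,
        h2K, Wd, inferInstance, inferInstance, hWd, hSel⟩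

/-- **The same under the binders of crux 22136** (`r_an(W) = 0` with the Gross–Zagier–Kolyvagin fact
`rank_eq_analyticRank_of_analyticRank_le_one` = item 19921 BY NAME; `ρ_{W,2^n}` onto for every `n ≥ 1`) — g8's
`supply_DEF1_minimalTwin_habitat_of_duality` with `prop33_rat` replaced by Kramer's congruence.
[cite: MazurRubin2010, Thm. 2.7, Prop. 3.3, Cor. 3.4 (i)] [cite: GrossLMS1991, §1 (p. 235)] -/
theorem supply_DEF1_minimalTwin_habitat_of_parity (hKP : MazurRubin2010.kramerParity ℚ)
    (hPT : poitouTate_selmerStructure_duality_real ℚ)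
    (hEP : ∀ v : IsDedekindDomain.HeightOneSpectrum (𝓞 ℚ), localEulerPoincareCharacteristic (v.adicCompletion ℚ))
    (hA : AdmissibleTwistSelmerShiftAtTwo) (hV : StrictShaPropagationAtTwo)
    (hGZK : rank_eq_analyticRank_of_analyticRank_le_one) (hr0 : W.analyticRank = 0)
    (hρ : ∀ n : ℕ, 0 < n → W.HasSurjectiveModNGaloisRep ((2 : ℤ) ^ n))
    (h14 : Nat.card (W.selmerGroup 2) = 1 ∨ Nat.card (W.selmerGroup 2) = 4)
    (hε : 0 < W.Δ → Nat.card (W.selmerGroup 2) = 4 → ¬ DescentSignNeg W) (b : ℕ) :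
    ∃ ℓ : ℕ, b < ℓ ∧ ℓ.Prime ∧ ℓ % 8 = 7 ∧ ¬ ℓ ∣ W.conductorNorm ℤ ∧
      ((W.Δ < 0 ∧ ∃! x : ZMod ℓ, 4 * x ^ 3 + ((integralModelInt W).b₂ : ZMod ℓ) * x ^ 2 +
          2 * ((integralModelInt W).b₄ : ZMod ℓ) * x + ((integralModelInt W).b₆ : ZMod ℓ) = 0) ∨
        (0 < W.Δ ∧ ∀ x : ZMod ℓ, 4 * x ^ 3 + ((integralModelInt W).b₂ : ZMod ℓ) * x ^ 2 +
          2 * ((integralModelInt W).b₄ : ZMod ℓ) * x + ((integralModelInt W).b₆ : ZMod ℓ) ≠ 0)) ∧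
      ∃ (K : Type) (_ : Field K) (_ : NumberField K), IsImaginaryQuadratic K ∧ discr K = -(ℓ : ℤ) ∧ Odd (discr K) ∧
        discr K ≠ -3 ∧ SatisfiesHeegnerHypothesis (W.conductorNorm ℤ) K ∧
        ¬ IsSquare ((discr K : ℚ) * -|W.Δ|) ∧ ¬ IsSquare ((discr K : ℚ) * (-(2 * |W.Δ|))) ∧
        ((Ideal.span {(2 : ℤ)}).primesOver (𝓞 K)).ncard = 2 ∧
        ∃ (Wd : WeierstrassCurve ℚ) (_ : Wd.IsElliptic) (_ : Wd.IsGloballyMinimal),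
          (∃ C : VariableChange ℚ, C • W.quadraticTwist (discr K : ℚ) = Wd) ∧ Nat.card (Wd.selmerGroup 2) = 2 := by
  have hr : W.mordellWeilRank = 0 := by rw [(hGZK W (by rw [hr0]; exact zero_le_one)).1, hr0]
  exact supply_DEF1_minimalTwin_of_parity W hKP hPT hEP hA hV (by simpa using hρ 1 one_pos) hr h14 hε b

end Summit.BirchSwinnertonDyer.BirchSwinnertonDyer.Theorems.GenusKolyTwin

end
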